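import Literature.NumberTheory.Automorphic.ArchPiMeasureInsert                -- (R3-f) step 2a (this seat): Fubini at one coordinate for updated families, Dirac ∕ orbit cases
import Literature.NumberTheory.Automorphic.ArchLocalRegularOrbitClosed           -- ★ `locallyCompactSpace_archLocal`, `secondCountableTopology_archLocal`
import Mathlib.Analysis.SpecialFunctions.Complex.Circle
import HarnessLib

/-!
# The DESCENT OVER PLACES for Lemma 14.5.2 (c) at `∞`: if the symmetrised mixed orbital integrals of a test function `Θ` on `∏_w U(½,−½)_w` vanish with `S` places regular and the
# others frozen at the centre, then `Θ` vanishes at the centre (one place at a time by Harish-Chandra's rank-one limit formula ★ `ArchRankOneLimitFormulaPartial`; Rogawski 1990 p. 238)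

Topic `NumberTheory/Automorphic`; namespace `Literature.NumberTheory.Automorphic.UnitaryGroup`.  THEOREMS ONLY (no `def`, no instance, no notation, no axiom, no named fact, no `sorry`).
Cell `pub/hodgecm-mathlib`, ENGINE T1 (crux H413 = `stmt-HodgeConjecture-24833`); ROAD-Sd residual R3 «(S-c) central vanishing» (`stub_ScCore` of `Cruxes/H413/Lines/F0_P3a_SdArch.lean`), brick
(R3-f) step 2b = census mechanism (M1) «IH(S) ⇒ IH(S ∖ w₁)» made a theorem; author F0P3a-p02 (g10), 2026-09-01.

THE DATA (no definitions — everything is a lambda in the statements).  `G_w = archLocal L 2 (diag α) w` (`α_i ≠ 0`, `σ_wα` real of opposite signs at EVERY complex place `w`: the endoscopic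
2-block `β₂ = (½, −½)` after ★ (R3-a)), Haar measures `νw w`, a smooth `Θ : M₂(L ⊗ ℝ) → E` with `g ↦ Θ ↑↑g` compactly supported on `G_∞ = U(diag α)(L⁺ ⊗ ℝ)`, central angles `z : W → S¹`
(the centre is `(diag(z_w, z_w))_w`), torus data `u : W → Fin 2 → S¹` and flips `ε : W → Bool`.  For a finite set `S` of places the MEASURE FAMILY `M(S, u, ε)_w` is the ORBIT MEASURE
`conj(diag(u_w^{ε_w}))_* νw w` (`u_w^{tt} = u_w ∘ swap`) for `w ∈ S` and the DIRAC MASS at `diag(z_w, z_w)` for `w ∉ S`; the SYMMETRISED MIXED ORBITAL INTEGRAL is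
`Σ_{ε : W → Bool} ∫ Θ ↑↑e⁻¹(o) d(⊗_w M(S, u, ε)_w)(o)` (flips off `S` are idle and only contribute a power of `2`).  At `S =` all places and `u` `G`-regular this is — up to the positive constants of
★ (R3-a)∕(R3-b) and the class bookkeeping of step 2c — the `H_∞`-side `Σ_{[γ] ⊂ st} ∫_{H_∞} aH(h γ h⁻¹) dνH` of (4.3.1) in Haar currency (★ `ArchDeltaTransferHaarForm`).

WHAT IS PROVED.
§0 small facts: `injective_of_apply_zero_ne_apply_one` (`Fin 2`), `comp_swap_eq` (`![a,b] ∘ swap = ![b,a]`), `mul_exp_ne_mul_exp_neg` (`z e^{iψ} ≠ z e^{−iψ}` for `0 < |ψ| < 1`),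
   `pi_dirac_eq_dirac` (`⊗_i δ_{x_i} = δ_x`), `sum_ite_apply_eq_of_update_invariant` (the flip-pairing identity `2 • Σ_ε ite(ε w₁) = Σ_ε (X ε + Y ε)` for `X`, `Y` blind to `ε w₁`).
§1 the measure family: `isFiniteMeasureOnCompacts_measureFamily`, `sigmaFinite_measureFamily` (Radon, σ-finite at every place when `u` is regular on `S`), `measureFamily_update_eq_update`
   (moving `u` at `w₁ ∈ S` = updating the family at `w₁` by the orbit measure), `measureFamily_eq_update_dirac` (`w₁ ∉ S`: the family IS its own update by the Dirac mass), integrability of `Θ ↑↑e⁻¹(·)`.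
§2 **`sum_integral_pi_erase_eq_zero_of_eventuallyEq`** — ONE DESCENT STEP: for `w₁ ∈ S`, `u` regular on `S ∖ w₁`, if along the central curve `u[w₁ ↦ (z e^{iψ}, z e^{−iψ})]` the function
   `ψ ↦ 2 sin ψ • Σ_ε ∫ Θ d(⊗ M(S, u_ψ, ε))` agrees on `𝓝[≠] 0` with some `r` differentiable there with `∂r → 0`, then `Σ_ε ∫ Θ d(⊗ M(S ∖ w₁, u, ε)) = 0`
   (★ p841213 §1 at `w₁` — ONE constant `C` for all `ε` — + §3 `finset_sum_eq_zero_of_tendsto_deriv_sub_comp_neg`, the flips at `w₁` being `ψ ↦ −ψ`; ★ `ArchPiMeasureInsert` moves `w₁` in and out).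
§3 **`apply_center_eq_zero_of_forall_sum_integral_pi_eq_zero`** — THE DESCENT: if `Σ_ε ∫ Θ d(⊗ M(S₀, u, ε)) = 0` for all `u` regular on `S₀`, then `Θ ↑↑e⁻¹((diag(z_w, z_w))_w) = 0`
   (downward induction `S₀ ∖ T`, `T ↑ S₀`, each step §2 with `r = 0`; at `T = S₀` all places are Dirac: `⊗_w δ = δ`).
USE ((R3-f) step 3, next): (vi) in Haar currency (★ `ArchDeltaTransferHaarForm`) + the `G′`-side flatness at the compact place `w₀` (★ p05 `tendsto_deriv_archExplicitDelta_centralCurve_mul`, ★ A-p18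
`ArchCompactPlaceOrbitalSmooth`) give §2's hypothesis at `S =` all places, `w₁ = w₀`; §2 then §3 at `S₀ = univ ∖ w₀` give `Θ(centre) = 0`, i.e. `aH(ζ•1) = 0` = `stub_ScCore`.
HONEST LABEL: HC_CM is proved only modulo the 7 printed citations until rung 0 closes; this file is real analysis ∕ measure bookkeeping over ★ (R1G)∘(R1-a) and pays nothing by itself.

## References
* [Rogawski1990] J. D. Rogawski, *Automorphic Representations of Unitary Groups in Three Variables*, Ann. of Math. Stud. 123 (1990), §14.5 Lemma 14.5.2 (c) p. 238; §8.4 pp. 126–127; §4.9 p. 54.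
* [Varadarajan1989] V. S. Varadarajan, *An Introduction to Harmonic Analysis on Semisimple Lie Groups* (1989), §6.4 Thm. 22.
* [BorelJacquet1979] A. Borel, H. Jacquet, *Automorphic forms and automorphic representations*, PSPM 33.1 (1979), §4.1.
-/

set_option autoImplicit false

noncomputable section

open MeasureTheory Matrix NumberField NumberField.InfinitePlace NumberField.mixedEmbedding Set Function Filter Topology
open scoped MatrixGroups ContDiff Real

-- the scoped `L^∞`-operator norm on `M_N(ℂ)` and `M_N(L ⊗ ℝ)`, the cell's ambient-smooth convention
open scoped Matrix.Norms.Operator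

namespace Literature.NumberTheory.Automorphic.UnitaryGroup

/-! ## §0 Small facts -/

section Small

/-- A `Fin 2`-indexed family with distinct entries is injective (regularity of `diag(a, b)`, `a ≠ b`). [cite: Rogawski1990, §4.9 p. 54] -/
theorem injective_of_apply_zero_ne_apply_one {β : Type*} (v : Fin 2 → β) (h : v 0 ≠ v 1) : Function.Injective v := by
  intro i j hij
  fin_cases i <;> fin_cases j
  · rfl
  · exact absurd hij h
  · exact absurd hij.symm h
  · rfl

/-- `![a, b] ∘ swap = ![b, a]` (the stable partner `diag(b, a)` of `diag(a, b)`). [cite: Rogawski1990, §4.9 p. 54] -/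
theorem comp_swap_eq {β : Type*} (a b : β) : (![a, b] ∘ ⇑(Equiv.swap (0 : Fin 2) 1)) = ![b, a] := by
  funext i
  fin_cases i <;> rfl

/-- `(v ∘ swap) 0 ≠ (v ∘ swap) 1 ↔ v 0 ≠ v 1`-direction used: the swapped family has distinct entries too. [cite: Rogawski1990, §4.9 p. 54] -/
theorem comp_swap_apply_zero_ne {β : Type*} (v : Fin 2 → β) (h : v 0 ≠ v 1) : (v ∘ ⇑(Equiv.swap (0 : Fin 2) 1)) 0 ≠ (v ∘ ⇑(Equiv.swap (0 : Fin 2) 1)) 1 := by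
  simp only [Function.comp_apply, Equiv.swap_apply_left, Equiv.swap_apply_right]
  exact fun h' => h h'.symm

/-- On `0 < |ψ| < 1` the central curve is regular: `z e^{iψ} ≠ z e^{−iψ}` (`e^{2iψ} = 1` forces `ψ ∈ πℤ`). [cite: Rogawski1990, §8.4 pp. 126–127] -/
theorem mul_exp_ne_mul_exp_neg (z : Circle) {ψ : ℝ} (hψ : ψ ∈ Ioo (-1 : ℝ) 1) (hψ0 : ψ ≠ 0) : z * Circle.exp ψ ≠ z * Circle.exp (-ψ) := by
  intro h
  have h1 : Circle.exp ψ = Circle.exp (-ψ) := mul_left_cancel h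
  obtain ⟨m, hm⟩ := Circle.exp_eq_exp.1 h1
  have hψ' : ψ = m * π := by linarith
  have hm0 : (m : ℝ) ≠ 0 := by
    intro hm0
    apply hψ0
    rw [hψ', hm0, zero_mul]
  have hm1 : (1 : ℝ) ≤ |(m : ℝ)| := by
    rw [← Int.cast_abs]
    exact_mod_cast Int.one_le_abs (by exact_mod_cast hm0)
  have hlt : |ψ| < 1 := abs_lt.2 ⟨hψ.1, hψ.2⟩
  rw [hψ', abs_mul, abs_of_pos Real.pi_pos] at hlt
  have : (1 : ℝ) * π ≤ |(m : ℝ)| * π := mul_le_mul_of_nonneg_right hm1 Real.pi_pos.le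
  linarith [Real.two_le_pi]

/-- **A finite product of Dirac masses is the Dirac mass of the tuple**: `⊗_i δ_{x_i} = δ_x`. [cite: BorelJacquet1979, §4.1] -/
theorem pi_dirac_eq_dirac {ι : Type*} [Fintype ι] {X : ι → Type*} [∀ i, MeasurableSpace (X i)] (x : ∀ i, X i) :
    Measure.pi (fun i => Measure.dirac (x i)) = Measure.dirac x := by
  refine Measure.pi_eq fun s hs => ?_
  rw [Measure.dirac_apply' _ (MeasurableSet.univ_pi hs)]
  simp_rw [Measure.dirac_apply' _ (hs _)]
  by_cases hx : x ∈ Set.univ.pi s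
  · rw [Set.indicator_of_mem hx, Pi.one_apply]
    refine (Finset.prod_eq_one fun i _ => ?_).symm
    rw [Set.indicator_of_mem (hx i (Set.mem_univ i)), Pi.one_apply]
  · rw [Set.indicator_of_notMem hx]
    obtain ⟨i, hi⟩ : ∃ i, x i ∉ s i := by
      by_contra hall
      push Not at hall
      exact hx fun i _ => hall i
    exact (Finset.prod_eq_zero (Finset.mem_univ i) (Set.indicator_of_notMem hi _)).symm

/-- **The flip pairing**: if `X`, `Y : (W → Bool) → E` do not see the coordinate `w₁`, then `2 • Σ_ε (if ε w₁ then X ε else Y ε) = Σ_ε (X ε + Y ε)` (re-index by the involution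
`ε ↦ ε[w₁ ↦ ¬ε w₁]`). [cite: Rogawski1990, §14.5 p. 238] -/
theorem two_smul_sum_ite_eq_sum_add {W : Type*} [Fintype W] [DecidableEq W] {E : Type*} [AddCommGroup E] [Module ℝ E] (w₁ : W) (X Y : (W → Bool) → E)
    (hX : ∀ ε b, X (Function.update ε w₁ b) = X ε) (hY : ∀ ε b, Y (Function.update ε w₁ b) = Y ε) :
    (2 : ℝ) • ∑ ε : W → Bool, (if ε w₁ then X ε else Y ε) = ∑ ε : W → Bool, (X ε + Y ε) := by
  -- the involution
  set τ : (W → Bool) → (W → Bool) := fun ε => Function.update ε w₁ (!ε w₁) with hτ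
  have hτi : Function.Involutive τ := by
    intro ε
    funext w
    by_cases h : w = w₁
    · subst h
      simp only [hτ, Function.update_self, Bool.not_not]
    · simp only [hτ, Function.update_of_ne h]
  have hsum : ∑ ε : W → Bool, (if ε w₁ then X ε else Y ε) = ∑ ε : W → Bool, (if ε w₁ then Y ε else X ε) := by
    refine Fintype.sum_bijective τ hτi.bijective _ _ fun ε => ?_
    have hw : τ ε w₁ = !ε w₁ := by simp only [hτ, Function.update_self]
    rw [hw, show X (τ ε) = X ε from hX ε _, show Y (τ ε) = Y ε from hY ε _]
    cases ε w₁ <;> rfl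
  rw [two_smul]
  conv_lhs => rw [hsum] ; arg 1; rw [← hsum]
  rw [← Finset.sum_add_distrib]
  refine Finset.sum_congr rfl fun ε _ => ?_
  cases ε w₁ <;> simp only [Bool.false_eq_true, ↓reduceIte, add_comm]

end Small

/-! ## §1 The measure family `M(S, u, ε)`: Radon, σ-finite, and its updates at one place -/

section Family

variable (L : Type) [Field L] [NumberField L] [IsCMField L] (α : Fin 2 → L)
  [∀ w : {w : InfinitePlace L // IsComplex w}, MeasurableSpace (archLocal L 2 (Matrix.diagonal α) w)]
  [∀ w : {w : InfinitePlace L // IsComplex w}, BorelSpace (archLocal L 2 (Matrix.diagonal α) w)]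
  (νw : ∀ w : {w : InfinitePlace L // IsComplex w}, Measure (archLocal L 2 (Matrix.diagonal α) w)) [∀ w, (νw w).IsHaarMeasure]
  (z : {w : InfinitePlace L // IsComplex w} → Circle)

omit [NumberField L] [IsCMField L] in
open scoped Classical in
/-- `M(S, u, ε)` is Radon at every place when `u` is regular on `S` (orbit measures at regular points ★ `isFiniteMeasureOnCompacts_map_conj_circleDiagonal`; Dirac masses).
[cite: Rogawski1990, §8.3 p. 122] -/
theorem isFiniteMeasureOnCompacts_measureFamily (hα : ∀ i, α i ≠ 0) (S : Finset {w : InfinitePlace L // IsComplex w}) (u : {w : InfinitePlace L // IsComplex w} → Fin 2 → Circle)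
    (hu : ∀ w ∈ S, u w 0 ≠ u w 1) (ε : {w : InfinitePlace L // IsComplex w} → Bool) (w : {w : InfinitePlace L // IsComplex w}) :
    IsFiniteMeasureOnCompacts ((fun w : {w : InfinitePlace L // IsComplex w} =>
          if w ∈ S then (νw w).map (fun g : archLocal L 2 (Matrix.diagonal α) w =>
            g * ⟨circleDiagonal 2 (if ε w then u w ∘ ⇑(Equiv.swap (0 : Fin 2) 1) else u w), circleDiagonal_mem_archLocal_diagonal L 2 α w _⟩ * g⁻¹)
          else Measure.dirac (⟨circleDiagonal 2 ![z w, z w], circleDiagonal_mem_archLocal_diagonal L 2 α w _⟩ : archLocal L 2 (Matrix.diagonal α) w)) w) := by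
  simp only []
  split_ifs with hw hε
  · exact isFiniteMeasureOnCompacts_map_conj_circleDiagonal L 2 α w hα _
      (injective_of_apply_zero_ne_apply_one _ (comp_swap_apply_zero_ne _ (hu w hw))) (νw w)
  · exact isFiniteMeasureOnCompacts_map_conj_circleDiagonal L 2 α w hα _ (injective_of_apply_zero_ne_apply_one _ (hu w hw)) (νw w)
  · infer_instance

omit [NumberField L] [IsCMField L] in
open scoped Classical in
/-- `M(S, u, ε)` is σ-finite at every place when `u` is regular on `S`. [cite: Rogawski1990, §8.3 p. 122] -/
theorem sigmaFinite_measureFamily (hα : ∀ i, α i ≠ 0) (S : Finset {w : InfinitePlace L // IsComplex w}) (u : {w : InfinitePlace L // IsComplex w} → Fin 2 → Circle)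
    (hu : ∀ w ∈ S, u w 0 ≠ u w 1) (ε : {w : InfinitePlace L // IsComplex w} → Bool) (w : {w : InfinitePlace L // IsComplex w}) :
    SigmaFinite ((fun w : {w : InfinitePlace L // IsComplex w} =>
          if w ∈ S then (νw w).map (fun g : archLocal L 2 (Matrix.diagonal α) w =>
            g * ⟨circleDiagonal 2 (if ε w then u w ∘ ⇑(Equiv.swap (0 : Fin 2) 1) else u w), circleDiagonal_mem_archLocal_diagonal L 2 α w _⟩ * g⁻¹)
          else Measure.dirac (⟨circleDiagonal 2 ![z w, z w], circleDiagonal_mem_archLocal_diagonal L 2 α w _⟩ : archLocal L 2 (Matrix.diagonal α) w)) w) := by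
  haveI : LocallyCompactSpace (archLocal L 2 (Matrix.diagonal α) w) := locallyCompactSpace_archLocal L 2 (Matrix.diagonal α) w
  haveI : SecondCountableTopology (archLocal L 2 (Matrix.diagonal α) w) := secondCountableTopology_archLocal L 2 (Matrix.diagonal α) w
  haveI := isFiniteMeasureOnCompacts_measureFamily L α νw z hα S u hu ε w
  infer_instance

omit [NumberField L] [IsCMField L] [∀ w : {w : InfinitePlace L // IsComplex w}, BorelSpace (archLocal L 2 (Matrix.diagonal α) w)] [∀ w, (νw w).IsHaarMeasure] in
open scoped Classical in
/-- **Moving `u` at `w₁ ∈ S` updates the family at `w₁` by the orbit measure** of the new point (flipped or not), the other places unchanged and equal to those of `S ∖ w₁`.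
[cite: Rogawski1990, §14.5 p. 238] -/
theorem measureFamily_update_eq_update (S : Finset {w : InfinitePlace L // IsComplex w}) (w₁ : {w : InfinitePlace L // IsComplex w}) (hw₁ : w₁ ∈ S) (u : {w : InfinitePlace L // IsComplex w} → Fin 2 → Circle)
    (v : Fin 2 → Circle) (ε : {w : InfinitePlace L // IsComplex w} → Bool) :
    (fun w : {w : InfinitePlace L // IsComplex w} =>
          if w ∈ S then (νw w).map (fun g : archLocal L 2 (Matrix.diagonal α) w =>
            g * ⟨circleDiagonal 2 (if ε w then (Function.update u w₁ v) w ∘ ⇑(Equiv.swap (0 : Fin 2) 1) else (Function.update u w₁ v) w), circleDiagonal_mem_archLocal_diagonal L 2 α w _⟩ * g⁻¹)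
          else Measure.dirac (⟨circleDiagonal 2 ![z w, z w], circleDiagonal_mem_archLocal_diagonal L 2 α w _⟩ : archLocal L 2 (Matrix.diagonal α) w)) =
      Function.update (fun w : {w : InfinitePlace L // IsComplex w} =>
          if w ∈ (S.erase w₁) then (νw w).map (fun g : archLocal L 2 (Matrix.diagonal α) w =>
            g * ⟨circleDiagonal 2 (if ε w then u w ∘ ⇑(Equiv.swap (0 : Fin 2) 1) else u w), circleDiagonal_mem_archLocal_diagonal L 2 α w _⟩ * g⁻¹)
          else Measure.dirac (⟨circleDiagonal 2 ![z w, z w], circleDiagonal_mem_archLocal_diagonal L 2 α w _⟩ : archLocal L 2 (Matrix.diagonal α) w)) w₁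
        ((νw w₁).map (fun g : archLocal L 2 (Matrix.diagonal α) w₁ =>
          g * ⟨circleDiagonal 2 (if ε w₁ then v ∘ ⇑(Equiv.swap (0 : Fin 2) 1) else v), circleDiagonal_mem_archLocal_diagonal L 2 α w₁ _⟩ * g⁻¹)) := by
  funext w
  by_cases h : w = w₁
  · subst h
    rw [Function.update_self]
    simp only [hw₁, ↓reduceIte, Function.update_self]
  · rw [Function.update_of_ne h]
    simp only [Finset.mem_erase, ne_eq, h, not_false_eq_true, true_and, Function.update_of_ne h]

omit [NumberField L] [IsCMField L] [∀ w : {w : InfinitePlace L // IsComplex w}, BorelSpace (archLocal L 2 (Matrix.diagonal α) w)] [∀ w, (νw w).IsHaarMeasure] in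
open scoped Classical in
/-- **Off `S` the family IS its update by the Dirac mass**: for `w₁ ∉ S`, `M(S,u,ε) = M(S,u,ε)[w₁ ↦ δ_{diag(z,z)}]`. [cite: Rogawski1990, §14.5 p. 238] -/
theorem measureFamily_eq_update_dirac (S : Finset {w : InfinitePlace L // IsComplex w}) (w₁ : {w : InfinitePlace L // IsComplex w}) (hw₁ : w₁ ∉ S) (u : {w : InfinitePlace L // IsComplex w} → Fin 2 → Circle) (ε : {w : InfinitePlace L // IsComplex w} → Bool) :
    (fun w : {w : InfinitePlace L // IsComplex w} =>
          if w ∈ S then (νw w).map (fun g : archLocal L 2 (Matrix.diagonal α) w =>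
            g * ⟨circleDiagonal 2 (if ε w then u w ∘ ⇑(Equiv.swap (0 : Fin 2) 1) else u w), circleDiagonal_mem_archLocal_diagonal L 2 α w _⟩ * g⁻¹)
          else Measure.dirac (⟨circleDiagonal 2 ![z w, z w], circleDiagonal_mem_archLocal_diagonal L 2 α w _⟩ : archLocal L 2 (Matrix.diagonal α) w)) =
      Function.update (fun w : {w : InfinitePlace L // IsComplex w} =>
          if w ∈ S then (νw w).map (fun g : archLocal L 2 (Matrix.diagonal α) w =>
            g * ⟨circleDiagonal 2 (if ε w then u w ∘ ⇑(Equiv.swap (0 : Fin 2) 1) else u w), circleDiagonal_mem_archLocal_diagonal L 2 α w _⟩ * g⁻¹)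
          else Measure.dirac (⟨circleDiagonal 2 ![z w, z w], circleDiagonal_mem_archLocal_diagonal L 2 α w _⟩ : archLocal L 2 (Matrix.diagonal α) w)) w₁
        (Measure.dirac (⟨circleDiagonal 2 ![z w₁, z w₁], circleDiagonal_mem_archLocal_diagonal L 2 α w₁ _⟩ : archLocal L 2 (Matrix.diagonal α) w₁)) := by
  have h : (fun w : {w : InfinitePlace L // IsComplex w} =>
          if w ∈ S then (νw w).map (fun g : archLocal L 2 (Matrix.diagonal α) w =>
            g * ⟨circleDiagonal 2 (if ε w then u w ∘ ⇑(Equiv.swap (0 : Fin 2) 1) else u w), circleDiagonal_mem_archLocal_diagonal L 2 α w _⟩ * g⁻¹)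
          else Measure.dirac (⟨circleDiagonal 2 ![z w, z w], circleDiagonal_mem_archLocal_diagonal L 2 α w _⟩ : archLocal L 2 (Matrix.diagonal α) w)) w₁ =
      Measure.dirac (⟨circleDiagonal 2 ![z w₁, z w₁], circleDiagonal_mem_archLocal_diagonal L 2 α w₁ _⟩ : archLocal L 2 (Matrix.diagonal α) w₁) := by
    simp only [hw₁, ↓reduceIte]
  conv_rhs => rw [← h]
  rw [Function.update_eq_self]

omit [∀ w : {w : InfinitePlace L // IsComplex w}, MeasurableSpace (archLocal L 2 (Matrix.diagonal α) w)]
  [∀ w : {w : InfinitePlace L // IsComplex w}, BorelSpace (archLocal L 2 (Matrix.diagonal α) w)] [∀ w, (νw w).IsHaarMeasure] in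
/-- The test function of the descent, `o ↦ Θ ↑↑e⁻¹(o)` on `∏_w G_w`, is continuous with compact support (hence integrable against any Radon σ-finite product and strongly measurable).
[cite: BorelJacquet1979, §4.1] -/
theorem continuous_hasCompactSupport_comp_archPiEquivCM_symm {E : Type*} [NormedAddCommGroup E]
    (Θ : Matrix (Fin 2) (Fin 2) (mixedSpace L) → E) (hΘ : Continuous Θ)
    (hΘc : HasCompactSupport (fun g : arch (↥(maximalRealSubfield L)) L (IsCMField.complexConj L) 2 (Matrix.diagonal α) =>
      Θ ((g : GL (Fin 2) (mixedSpace L)) : Matrix (Fin 2) (Fin 2) (mixedSpace L)))) :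
    Continuous (fun o : (∀ w : {w : InfinitePlace L // IsComplex w}, archLocal L 2 (Matrix.diagonal α) w) => Θ ((((archPiEquivCM 2 L (Matrix.diagonal α)).symm o : arch (↥(maximalRealSubfield L)) L (IsCMField.complexConj L) 2 (Matrix.diagonal α)) : GL (Fin 2) (mixedSpace L)) : Matrix (Fin 2) (Fin 2) (mixedSpace L))) ∧
      HasCompactSupport (fun o : (∀ w : {w : InfinitePlace L // IsComplex w}, archLocal L 2 (Matrix.diagonal α) w) => Θ ((((archPiEquivCM 2 L (Matrix.diagonal α)).symm o : arch (↥(maximalRealSubfield L)) L (IsCMField.complexConj L) 2 (Matrix.diagonal α)) : GL (Fin 2) (mixedSpace L)) : Matrix (Fin 2) (Fin 2) (mixedSpace L))) := by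
  have hι : Continuous fun g : arch (↥(maximalRealSubfield L)) L (IsCMField.complexConj L) 2 (Matrix.diagonal α) =>
      ((g : GL (Fin 2) (mixedSpace L)) : Matrix (Fin 2) (Fin 2) (mixedSpace L)) := Units.continuous_val.comp continuous_subtype_val
  refine ⟨(hΘ.comp hι).comp (archPiEquivCM 2 L (Matrix.diagonal α)).symm.continuous, ?_⟩
  exact hΘc.comp_homeomorph (archPiEquivCM 2 L (Matrix.diagonal α)).symm.toHomeomorph

end Family

/-! ## §2 One descent step: `w₁` leaves `S` -/

section Step

variable (L : Type) [Field L] [NumberField L] [IsCMField L] (α : Fin 2 → L)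
  [∀ w : {w : InfinitePlace L // IsComplex w}, MeasurableSpace (archLocal L 2 (Matrix.diagonal α) w)]
  [∀ w : {w : InfinitePlace L // IsComplex w}, BorelSpace (archLocal L 2 (Matrix.diagonal α) w)]
  (νw : ∀ w : {w : InfinitePlace L // IsComplex w}, Measure (archLocal L 2 (Matrix.diagonal α) w)) [∀ w, (νw w).IsHaarMeasure]
  (z : {w : InfinitePlace L // IsComplex w} → Circle)

open scoped Classical in
/-- **ONE DESCENT STEP** (census (M1): `IH(S) ⇒ IH(S ∖ w₁)`).  Let `w₁ ∈ S`, `u` regular on `S ∖ w₁`, and suppose that along the central curve at `w₁`,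
`u_ψ = u[w₁ ↦ (z e^{iψ}, z e^{−iψ})]`, the symmetrised mixed orbital integral `ψ ↦ 2 sin ψ • Σ_ε ∫ Θ d(⊗ M(S, u_ψ, ε))` agrees on `𝓝[≠] 0` with a function `r` differentiable there
whose derivative tends to `0` (`r = 0` inside the descent; `r` = the `G′`-side of (4.3.1) at the first step).  Then `Σ_ε ∫ Θ d(⊗ M(S ∖ w₁, u, ε)) = 0`.
Mechanism: ★ `ArchPiMeasureInsert` writes each term as `∫_{k∼νw w₁} ∫_o Θ(e⁻¹(k·diag(u_ψ^{ε})·k⁻¹, o)) d(⊗_{w′≠w₁} M(S∖w₁,u,ε))`, the flip at `w₁` is `ψ ↦ −ψ`, so `2 sin ψ • Σ_ε(…)` is HALF the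
symmetrised sum `Σ_ε [g_ε(ψ) − g_ε(−ψ)]` of ★ p841213 §3 (`two_smul_sum_ite_eq_sum_add`); ★ p841213 §1 gives `∂g_ε → C • V_ε` with ONE `C ≠ 0`, `V_ε = ∫ Θ(e⁻¹(diag(z,z), o)) d(⊗_{w′≠w₁} …)`
`= ∫ Θ d(⊗ M(S∖w₁,u,ε))` (Dirac at `w₁`, ★ `integral_pi_update_dirac_archLocal`); `finset_sum_eq_zero_of_tendsto_deriv_sub_comp_neg` concludes.
[cite: Rogawski1990, §14.5 Lemma 14.5.2 (c) p. 238; §8.4 pp. 126–127] [cite: Varadarajan1989, §6.4 Thm. 22] -/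
theorem sum_integral_pi_erase_eq_zero_of_eventuallyEq {E : Type*} [NormedAddCommGroup E] [NormedSpace ℝ E] [CompleteSpace E]
    (hα : ∀ i, α i ≠ 0) (Θ : Matrix (Fin 2) (Fin 2) (mixedSpace L) → E) (hΘ : ContDiff ℝ (⊤ : ℕ∞) Θ)
    (hΘc : HasCompactSupport (fun g : arch (↥(maximalRealSubfield L)) L (IsCMField.complexConj L) 2 (Matrix.diagonal α) =>
      Θ ((g : GL (Fin 2) (mixedSpace L)) : Matrix (Fin 2) (Fin 2) (mixedSpace L))))
    (S : Finset {w : InfinitePlace L // IsComplex w}) (w₁ : {w : InfinitePlace L // IsComplex w}) (hw₁ : w₁ ∈ S)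
    (hreal : ∀ i, (w₁.1.embedding (α i)).im = 0) (hsgn : (w₁.1.embedding (α 0)).re * (w₁.1.embedding (α 1)).re < 0)
    (u : {w : InfinitePlace L // IsComplex w} → Fin 2 → Circle) (hu : ∀ w ∈ S, w ≠ w₁ → u w 0 ≠ u w 1)
    (r : ℝ → E) (hrd : ∀ᶠ ψ in 𝓝[≠] (0 : ℝ), DifferentiableAt ℝ r ψ) (hr : Tendsto (fun ψ : ℝ => deriv r ψ) (𝓝[≠] 0) (𝓝 0))
    (heq : ∀ᶠ ψ in 𝓝[≠] (0 : ℝ), (2 * Real.sin ψ) • ∑ ε : {w : InfinitePlace L // IsComplex w} → Bool,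
      ∫ o, Θ (((((archPiEquivCM 2 L (Matrix.diagonal α)).symm o) : arch (↥(maximalRealSubfield L)) L (IsCMField.complexConj L) 2 (Matrix.diagonal α)) : GL (Fin 2) (mixedSpace L)) : Matrix (Fin 2) (Fin 2) (mixedSpace L))
          ∂(Measure.pi (fun w : {w : InfinitePlace L // IsComplex w} =>
          if w ∈ S then (νw w).map (fun g : archLocal L 2 (Matrix.diagonal α) w =>
            g * ⟨circleDiagonal 2 (if ε w then (Function.update u w₁ ![z w₁ * Circle.exp ψ, z w₁ * Circle.exp (-ψ)]) w ∘ ⇑(Equiv.swap (0 : Fin 2) 1) else (Function.update u w₁ ![z w₁ * Circle.exp ψ, z w₁ * Circle.exp (-ψ)]) w), circleDiagonal_mem_archLocal_diagonal L 2 α w _⟩ * g⁻¹)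
          else Measure.dirac (⟨circleDiagonal 2 ![z w, z w], circleDiagonal_mem_archLocal_diagonal L 2 α w _⟩ : archLocal L 2 (Matrix.diagonal α) w))) = r ψ) :
    ∑ ε : {w : InfinitePlace L // IsComplex w} → Bool,
      ∫ o, Θ (((((archPiEquivCM 2 L (Matrix.diagonal α)).symm o) : arch (↥(maximalRealSubfield L)) L (IsCMField.complexConj L) 2 (Matrix.diagonal α)) : GL (Fin 2) (mixedSpace L)) : Matrix (Fin 2) (Fin 2) (mixedSpace L))
          ∂(Measure.pi (fun w : {w : InfinitePlace L // IsComplex w} =>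
          if w ∈ S.erase w₁ then (νw w).map (fun g : archLocal L 2 (Matrix.diagonal α) w =>
            g * ⟨circleDiagonal 2 (if ε w then u w ∘ ⇑(Equiv.swap (0 : Fin 2) 1) else u w), circleDiagonal_mem_archLocal_diagonal L 2 α w _⟩ * g⁻¹)
          else Measure.dirac (⟨circleDiagonal 2 ![z w, z w], circleDiagonal_mem_archLocal_diagonal L 2 α w _⟩ : archLocal L 2 (Matrix.diagonal α) w))) = 0 := by
  haveI : ∀ w : {w : InfinitePlace L // IsComplex w}, SecondCountableTopology (archLocal L 2 (Matrix.diagonal α) w) := fun w => secondCountableTopology_archLocal L 2 (Matrix.diagonal α) w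
  haveI : ∀ w : {w : InfinitePlace L // IsComplex w}, LocallyCompactSpace (archLocal L 2 (Matrix.diagonal α) w) := fun w => locallyCompactSpace_archLocal L 2 (Matrix.diagonal α) w
  -- regularity of `u` on `S ∖ w₁`; the families `M(S ∖ w₁, u, ε)` are Radon and σ-finite
  have hu' : ∀ w ∈ S.erase w₁, u w 0 ≠ u w 1 := fun w hw => hu w (Finset.mem_of_mem_erase hw) (Finset.ne_of_mem_erase hw)
  haveI hR : ∀ (ε : {w : InfinitePlace L // IsComplex w} → Bool) (w : {w : InfinitePlace L // IsComplex w}), IsFiniteMeasureOnCompacts ((fun w : {w : InfinitePlace L // IsComplex w} =>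
          if w ∈ S.erase w₁ then (νw w).map (fun g : archLocal L 2 (Matrix.diagonal α) w =>
            g * ⟨circleDiagonal 2 (if ε w then u w ∘ ⇑(Equiv.swap (0 : Fin 2) 1) else u w), circleDiagonal_mem_archLocal_diagonal L 2 α w _⟩ * g⁻¹)
          else Measure.dirac (⟨circleDiagonal 2 ![z w, z w], circleDiagonal_mem_archLocal_diagonal L 2 α w _⟩ : archLocal L 2 (Matrix.diagonal α) w)) w) :=
    fun ε w => isFiniteMeasureOnCompacts_measureFamily L α νw z hα _ u hu' ε w
  haveI hσ : ∀ (ε : {w : InfinitePlace L // IsComplex w} → Bool) (w : {w : InfinitePlace L // IsComplex w}), SigmaFinite ((fun w : {w : InfinitePlace L // IsComplex w} =>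
          if w ∈ S.erase w₁ then (νw w).map (fun g : archLocal L 2 (Matrix.diagonal α) w =>
            g * ⟨circleDiagonal 2 (if ε w then u w ∘ ⇑(Equiv.swap (0 : Fin 2) 1) else u w), circleDiagonal_mem_archLocal_diagonal L 2 α w _⟩ * g⁻¹)
          else Measure.dirac (⟨circleDiagonal 2 ![z w, z w], circleDiagonal_mem_archLocal_diagonal L 2 α w _⟩ : archLocal L 2 (Matrix.diagonal α) w)) w) :=
    fun ε w => sigmaFinite_measureFamily L α νw z hα _ u hu' ε w
  -- the test function on `∏_w G_w`
  set F : (∀ w : {w : InfinitePlace L // IsComplex w}, archLocal L 2 (Matrix.diagonal α) w) → E := fun o => Θ (((((archPiEquivCM 2 L (Matrix.diagonal α)).symm o) : arch (↥(maximalRealSubfield L)) L (IsCMField.complexConj L) 2 (Matrix.diagonal α)) : GL (Fin 2) (mixedSpace L)) : Matrix (Fin 2) (Fin 2) (mixedSpace L)) with hF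
  obtain ⟨hFc, hFs⟩ := continuous_hasCompactSupport_comp_archPiEquivCM_symm L α Θ hΘ.continuous hΘc
  have hFm : StronglyMeasurable F := hFc.stronglyMeasurable
  -- the other-place families, blind to `ε w₁`
  set μ' : ({w : InfinitePlace L // IsComplex w} → Bool) → ∀ w' : {w : {w : InfinitePlace L // IsComplex w} // ¬ w = w₁}, Measure (archLocal L 2 (Matrix.diagonal α) w'.1) :=
    fun ε w' => (fun w : {w : InfinitePlace L // IsComplex w} =>
          if w ∈ S.erase w₁ then (νw w).map (fun g : archLocal L 2 (Matrix.diagonal α) w =>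
            g * ⟨circleDiagonal 2 (if ε w then u w ∘ ⇑(Equiv.swap (0 : Fin 2) 1) else u w), circleDiagonal_mem_archLocal_diagonal L 2 α w _⟩ * g⁻¹)
          else Measure.dirac (⟨circleDiagonal 2 ![z w, z w], circleDiagonal_mem_archLocal_diagonal L 2 α w _⟩ : archLocal L 2 (Matrix.diagonal α) w)) w'.1 with hμ'
  haveI : ∀ ε w', IsFiniteMeasureOnCompacts (μ' ε w') := fun ε w' => hR ε w'.1
  haveI : ∀ ε w', SigmaFinite (μ' ε w') := fun ε w' => hσ ε w'.1
  have hμ'u : ∀ ε b, μ' (Function.update ε w₁ b) = μ' ε := by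
    intro ε b
    funext w'
    simp only [hμ', Function.update_of_ne w'.2]
  -- the engine at `w₁`: ONE constant for all `ε`
  obtain ⟨C, hC, hlim⟩ := exists_tendsto_deriv_two_sin_smul_integral_integral_insert (E := E) L α hα w₁ hreal hsgn (νw w₁)
  set g : ({w : InfinitePlace L // IsComplex w} → Bool) → ℝ → E := fun ε ψ => (2 * Real.sin ψ) •
    ∫ k : archLocal L 2 (Matrix.diagonal α) w₁, ∫ o : (∀ w' : {w : {w : InfinitePlace L // IsComplex w} // ¬ w = w₁}, archLocal L 2 (Matrix.diagonal α) w'.1),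
      Θ (((((archPiEquivCM 2 L (Matrix.diagonal α)).symm ((MeasurableEquiv.piEquivPiSubtypeProd (fun w : {w : InfinitePlace L // IsComplex w} => ↥(archLocal L 2 (Matrix.diagonal α) w)) (· = w₁)).symm
              ((MeasurableEquiv.piUnique fun i : {w : {w : InfinitePlace L // IsComplex w} // w = w₁} => ↥(archLocal L 2 (Matrix.diagonal α) i.1)).symm
                (k * ⟨circleDiagonal 2 ![z w₁ * Circle.exp ψ, z w₁ * Circle.exp (-ψ)], circleDiagonal_mem_archLocal_diagonal L 2 α w₁ _⟩ * k⁻¹), o))) : arch (↥(maximalRealSubfield L)) L (IsCMField.complexConj L) 2 (Matrix.diagonal α)) : GL (Fin 2) (mixedSpace L)) : Matrix (Fin 2) (Fin 2) (mixedSpace L))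
      ∂(Measure.pi (μ' ε)) ∂(νw w₁) with hg
  set V : ({w : InfinitePlace L // IsComplex w} → Bool) → E := fun ε =>
    ∫ o : (∀ w' : {w : {w : InfinitePlace L // IsComplex w} // ¬ w = w₁}, archLocal L 2 (Matrix.diagonal α) w'.1),
      Θ (((((archPiEquivCM 2 L (Matrix.diagonal α)).symm ((MeasurableEquiv.piEquivPiSubtypeProd (fun w : {w : InfinitePlace L // IsComplex w} => ↥(archLocal L 2 (Matrix.diagonal α) w)) (· = w₁)).symm
              ((MeasurableEquiv.piUnique fun i : {w : {w : InfinitePlace L // IsComplex w} // w = w₁} => ↥(archLocal L 2 (Matrix.diagonal α) i.1)).symm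
                ((⟨circleDiagonal 2 ![z w₁, z w₁], circleDiagonal_mem_archLocal_diagonal L 2 α w₁ _⟩ : archLocal L 2 (Matrix.diagonal α) w₁)), o))) : arch (↥(maximalRealSubfield L)) L (IsCMField.complexConj L) 2 (Matrix.diagonal α)) : GL (Fin 2) (mixedSpace L)) : Matrix (Fin 2) (Fin 2) (mixedSpace L))
      ∂(Measure.pi (μ' ε)) with hV
  have hgl : ∀ ε, Tendsto (fun ψ : ℝ => deriv (g ε) ψ) (𝓝[≠] 0) (𝓝 (C • V ε)) ∧
      ∀ ψ ∈ Ioo (-1 : ℝ) 1, ψ ≠ 0 → DifferentiableAt ℝ (g ε) ψ := fun ε => hlim (μ' ε) Θ hΘ hΘc (z w₁)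
  have hgu : ∀ ε b, g (Function.update ε w₁ b) = g ε := fun ε b => by simp only [hg, hμ'u]
  -- `V ε` is the Dirac-at-`w₁` integral over `M(S ∖ w₁, u, ε)`
  have hVint : ∀ ε, V ε = ∫ o, Θ (((((archPiEquivCM 2 L (Matrix.diagonal α)).symm o) : arch (↥(maximalRealSubfield L)) L (IsCMField.complexConj L) 2 (Matrix.diagonal α)) : GL (Fin 2) (mixedSpace L)) : Matrix (Fin 2) (Fin 2) (mixedSpace L))
          ∂(Measure.pi (fun w : {w : InfinitePlace L // IsComplex w} =>
          if w ∈ S.erase w₁ then (νw w).map (fun g : archLocal L 2 (Matrix.diagonal α) w =>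
            g * ⟨circleDiagonal 2 (if ε w then u w ∘ ⇑(Equiv.swap (0 : Fin 2) 1) else u w), circleDiagonal_mem_archLocal_diagonal L 2 α w _⟩ * g⁻¹)
          else Measure.dirac (⟨circleDiagonal 2 ![z w, z w], circleDiagonal_mem_archLocal_diagonal L 2 α w _⟩ : archLocal L 2 (Matrix.diagonal α) w))) := by
    intro ε
    have h1 : (∫ o, Θ (((((archPiEquivCM 2 L (Matrix.diagonal α)).symm o) : arch (↥(maximalRealSubfield L)) L (IsCMField.complexConj L) 2 (Matrix.diagonal α)) : GL (Fin 2) (mixedSpace L)) : Matrix (Fin 2) (Fin 2) (mixedSpace L))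
          ∂(Measure.pi (fun w : {w : InfinitePlace L // IsComplex w} =>
          if w ∈ S.erase w₁ then (νw w).map (fun g : archLocal L 2 (Matrix.diagonal α) w =>
            g * ⟨circleDiagonal 2 (if ε w then u w ∘ ⇑(Equiv.swap (0 : Fin 2) 1) else u w), circleDiagonal_mem_archLocal_diagonal L 2 α w _⟩ * g⁻¹)
          else Measure.dirac (⟨circleDiagonal 2 ![z w, z w], circleDiagonal_mem_archLocal_diagonal L 2 α w _⟩ : archLocal L 2 (Matrix.diagonal α) w)))) =
        ∫ o, F o ∂(Measure.pi (Function.update (fun w : {w : InfinitePlace L // IsComplex w} =>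
          if w ∈ S.erase w₁ then (νw w).map (fun g : archLocal L 2 (Matrix.diagonal α) w =>
            g * ⟨circleDiagonal 2 (if ε w then u w ∘ ⇑(Equiv.swap (0 : Fin 2) 1) else u w), circleDiagonal_mem_archLocal_diagonal L 2 α w _⟩ * g⁻¹)
          else Measure.dirac (⟨circleDiagonal 2 ![z w, z w], circleDiagonal_mem_archLocal_diagonal L 2 α w _⟩ : archLocal L 2 (Matrix.diagonal α) w)) w₁
          (Measure.dirac (⟨circleDiagonal 2 ![z w₁, z w₁], circleDiagonal_mem_archLocal_diagonal L 2 α w₁ _⟩ : archLocal L 2 (Matrix.diagonal α) w₁)))) := by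
      rw [← measureFamily_eq_update_dirac L α νw z (S.erase w₁) w₁ (Finset.notMem_erase w₁ S) u ε]
    rw [h1, integral_pi_update_dirac_archLocal L 2 α _ w₁ _ F (integrable_pi_update_of_hasCompactSupport _ w₁ _ F hFc hFs)]
  -- each term of the hypothesis, in the iterated currency: `2 sin ψ • ∫ Θ d(⊗ M(S, u_ψ, ε)) = g_ε(ψ)` or `−g_ε(−ψ)`
  have hI : ∀ ψ ∈ Ioo (-1 : ℝ) 1, ψ ≠ 0 → (2 * Real.sin ψ) • ∑ ε : {w : InfinitePlace L // IsComplex w} → Bool,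
      ∫ o, Θ (((((archPiEquivCM 2 L (Matrix.diagonal α)).symm o) : arch (↥(maximalRealSubfield L)) L (IsCMField.complexConj L) 2 (Matrix.diagonal α)) : GL (Fin 2) (mixedSpace L)) : Matrix (Fin 2) (Fin 2) (mixedSpace L))
          ∂(Measure.pi (fun w : {w : InfinitePlace L // IsComplex w} =>
          if w ∈ S then (νw w).map (fun g : archLocal L 2 (Matrix.diagonal α) w =>
            g * ⟨circleDiagonal 2 (if ε w then (Function.update u w₁ ![z w₁ * Circle.exp ψ, z w₁ * Circle.exp (-ψ)]) w ∘ ⇑(Equiv.swap (0 : Fin 2) 1) else (Function.update u w₁ ![z w₁ * Circle.exp ψ, z w₁ * Circle.exp (-ψ)]) w), circleDiagonal_mem_archLocal_diagonal L 2 α w _⟩ * g⁻¹)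
          else Measure.dirac (⟨circleDiagonal 2 ![z w, z w], circleDiagonal_mem_archLocal_diagonal L 2 α w _⟩ : archLocal L 2 (Matrix.diagonal α) w))) =
      ∑ ε : {w : InfinitePlace L // IsComplex w} → Bool, (if ε w₁ then -(g ε (-ψ)) else g ε ψ) := by
    intro ψ hψ hψ0
    rw [Finset.smul_sum]
    refine Finset.sum_congr rfl fun ε _ => ?_
    have hreg : z w₁ * Circle.exp ψ ≠ z w₁ * Circle.exp (-ψ) := mul_exp_ne_mul_exp_neg (z w₁) hψ hψ0
    have hinj : Function.Injective (if ε w₁ then ![z w₁ * Circle.exp ψ, z w₁ * Circle.exp (-ψ)] ∘ ⇑(Equiv.swap (0 : Fin 2) 1) else ![z w₁ * Circle.exp ψ, z w₁ * Circle.exp (-ψ)]) := by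
      split_ifs
      · exact injective_of_apply_zero_ne_apply_one _ (comp_swap_apply_zero_ne _ hreg)
      · exact injective_of_apply_zero_ne_apply_one _ hreg
    haveI := isFiniteMeasureOnCompacts_map_conj_circleDiagonal L 2 α w₁ hα _ hinj (νw w₁)
    haveI := sigmaFinite_map_conj_circleDiagonal L 2 α w₁ hα _ hinj (νw w₁)
    rw [measureFamily_update_eq_update L α νw z S w₁ hw₁ u _ ε,
      show (∫ o, Θ (((((archPiEquivCM 2 L (Matrix.diagonal α)).symm o) : arch (↥(maximalRealSubfield L)) L (IsCMField.complexConj L) 2 (Matrix.diagonal α)) : GL (Fin 2) (mixedSpace L)) : Matrix (Fin 2) (Fin 2) (mixedSpace L))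
        ∂(Measure.pi (Function.update (fun w : {w : InfinitePlace L // IsComplex w} =>
          if w ∈ S.erase w₁ then (νw w).map (fun g : archLocal L 2 (Matrix.diagonal α) w =>
            g * ⟨circleDiagonal 2 (if ε w then u w ∘ ⇑(Equiv.swap (0 : Fin 2) 1) else u w), circleDiagonal_mem_archLocal_diagonal L 2 α w _⟩ * g⁻¹)
          else Measure.dirac (⟨circleDiagonal 2 ![z w, z w], circleDiagonal_mem_archLocal_diagonal L 2 α w _⟩ : archLocal L 2 (Matrix.diagonal α) w)) w₁
          ((νw w₁).map (fun g : archLocal L 2 (Matrix.diagonal α) w₁ =>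
            g * ⟨circleDiagonal 2 (if ε w₁ then ![z w₁ * Circle.exp ψ, z w₁ * Circle.exp (-ψ)] ∘ ⇑(Equiv.swap (0 : Fin 2) 1) else ![z w₁ * Circle.exp ψ, z w₁ * Circle.exp (-ψ)]),
              circleDiagonal_mem_archLocal_diagonal L 2 α w₁ _⟩ * g⁻¹))))) = ∫ o, F o ∂_ from rfl,
      integral_pi_update_map_conj_circleDiagonal_archLocal L 2 α _ w₁ _ (νw w₁) F hFm
        (integrable_pi_update_of_hasCompactSupport _ w₁ _ F hFc hFs)]
    cases hb : ε w₁
    · simp only [Bool.false_eq_true, ↓reduceIte, hg, hF, hμ']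
    · simp only [↓reduceIte, hg, hF, hμ', comp_swap_eq, Real.sin_neg, mul_neg, neg_smul, neg_neg]
  -- the symmetrised sum is `2 • r` near `0`
  have hIoo : ∀ᶠ ψ : ℝ in 𝓝[≠] 0, ψ ∈ Ioo (-1 : ℝ) 1 ∧ ψ ≠ 0 :=
    Filter.inter_mem (mem_nhdsWithin_of_mem_nhds (Ioo_mem_nhds (by norm_num) (by norm_num))) self_mem_nhdsWithin
  have hFr : (fun ψ : ℝ => ∑ ε ∈ (Finset.univ : Finset ({w : InfinitePlace L // IsComplex w} → Bool)), (g ε ψ - g ε (-ψ))) =ᶠ[𝓝[≠] (0 : ℝ)] fun ψ => (2 : ℝ) • r ψ := by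
    filter_upwards [heq, hIoo] with ψ hψr hψ
    rw [← hψr, hI ψ hψ.1 hψ.2, two_smul_sum_ite_eq_sum_add w₁ (fun ε => -(g ε (-ψ))) (fun ε => g ε ψ)
      (fun ε b => by simp only [hgu]) (fun ε b => by simp only [hgu])]
    refine Finset.sum_congr rfl fun ε _ => ?_
    rw [sub_eq_add_neg, add_comm]
  have hr2 : Tendsto (fun ψ : ℝ => deriv (fun ψ : ℝ => (2 : ℝ) • r ψ) ψ) (𝓝[≠] 0) (𝓝 0) := by
    have h : (fun ψ : ℝ => deriv (fun ψ : ℝ => (2 : ℝ) • r ψ) ψ) =ᶠ[𝓝[≠] (0 : ℝ)] fun ψ => (2 : ℝ) • deriv r ψ := by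
      filter_upwards [hrd] with ψ hψ
      exact deriv_const_smul (2 : ℝ) hψ
    rw [Filter.tendsto_congr' h]
    simpa only [smul_zero] using hr.const_smul (2 : ℝ)
  have hmain := finset_sum_eq_zero_of_tendsto_deriv_sub_comp_neg (Finset.univ : Finset ({w : InfinitePlace L // IsComplex w} → Bool)) g V hC
    (fun ε _ => (hgl ε).2) (fun ε _ => (hgl ε).1) (fun ψ => (2 : ℝ) • r ψ) hr2 hFr
  rw [Finset.sum_congr rfl fun ε _ => hVint ε] at hmain
  exact hmain

end Step

/-! ## §3 The descent to the centre -/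

section Descent

variable (L : Type) [Field L] [NumberField L] [IsCMField L] (α : Fin 2 → L)
  [∀ w : {w : InfinitePlace L // IsComplex w}, MeasurableSpace (archLocal L 2 (Matrix.diagonal α) w)]
  [∀ w : {w : InfinitePlace L // IsComplex w}, BorelSpace (archLocal L 2 (Matrix.diagonal α) w)]
  (νw : ∀ w : {w : InfinitePlace L // IsComplex w}, Measure (archLocal L 2 (Matrix.diagonal α) w)) [∀ w, (νw w).IsHaarMeasure]
  (z : {w : InfinitePlace L // IsComplex w} → Circle)

open scoped Classical in
/-- **THE DESCENT TO THE CENTRE** (census (M1) «IH(S₀) ⇒ IH(∅)»).  On the endoscopic-type 2-block (`σ_wα` real of opposite signs at EVERY complex place, e.g. `β₂ = (½, −½)`): if for every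
`u` regular on `S₀` the symmetrised mixed orbital integral `Σ_ε ∫ Θ d(⊗ M(S₀, u, ε))` vanishes, then `Θ` VANISHES AT THE CENTRE `(diag(z_w, z_w))_w`
(downward induction over `T ↑ S₀` with §2 at `r = 0`; at the end every place carries a Dirac mass and `⊗_w δ = δ`).  With `S₀ = univ ∖ w₀` and the hypothesis supplied by (vi) in Haar currency
(★ `ArchDeltaTransferHaarForm`) + flatness at the compact place `w₀`, this is `aH(ζ•1) = 0`, Lemma 14.5.2 (c) at `∞`.
[cite: Rogawski1990, §14.5 Lemma 14.5.2 (c) p. 238; §8.4 pp. 126–127] [cite: Varadarajan1989, §6.4 Thm. 22] -/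
theorem apply_center_eq_zero_of_forall_sum_integral_pi_eq_zero {E : Type*} [NormedAddCommGroup E] [NormedSpace ℝ E] [CompleteSpace E]
    (hα : ∀ i, α i ≠ 0) (Θ : Matrix (Fin 2) (Fin 2) (mixedSpace L) → E) (hΘ : ContDiff ℝ (⊤ : ℕ∞) Θ)
    (hΘc : HasCompactSupport (fun g : arch (↥(maximalRealSubfield L)) L (IsCMField.complexConj L) 2 (Matrix.diagonal α) =>
      Θ ((g : GL (Fin 2) (mixedSpace L)) : Matrix (Fin 2) (Fin 2) (mixedSpace L))))
    (hreal : ∀ (w : {w : InfinitePlace L // IsComplex w}) (i : Fin 2), (w.1.embedding (α i)).im = 0)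
    (hsgn : ∀ w : {w : InfinitePlace L // IsComplex w}, (w.1.embedding (α 0)).re * (w.1.embedding (α 1)).re < 0)
    (S₀ : Finset {w : InfinitePlace L // IsComplex w})
    (hQ : ∀ u : {w : InfinitePlace L // IsComplex w} → Fin 2 → Circle, (∀ w ∈ S₀, u w 0 ≠ u w 1) →
      ∑ ε : {w : InfinitePlace L // IsComplex w} → Bool,
        ∫ o, Θ (((((archPiEquivCM 2 L (Matrix.diagonal α)).symm o) : arch (↥(maximalRealSubfield L)) L (IsCMField.complexConj L) 2 (Matrix.diagonal α)) : GL (Fin 2) (mixedSpace L)) : Matrix (Fin 2) (Fin 2) (mixedSpace L))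
          ∂(Measure.pi (fun w : {w : InfinitePlace L // IsComplex w} =>
          if w ∈ S₀ then (νw w).map (fun g : archLocal L 2 (Matrix.diagonal α) w =>
            g * ⟨circleDiagonal 2 (if ε w then u w ∘ ⇑(Equiv.swap (0 : Fin 2) 1) else u w), circleDiagonal_mem_archLocal_diagonal L 2 α w _⟩ * g⁻¹)
          else Measure.dirac (⟨circleDiagonal 2 ![z w, z w], circleDiagonal_mem_archLocal_diagonal L 2 α w _⟩ : archLocal L 2 (Matrix.diagonal α) w))) = 0) :
    Θ (((((archPiEquivCM 2 L (Matrix.diagonal α)).symm (fun w : {w : InfinitePlace L // IsComplex w} => (⟨circleDiagonal 2 ![z w, z w], circleDiagonal_mem_archLocal_diagonal L 2 α w _⟩ : archLocal L 2 (Matrix.diagonal α) w))) : arch (↥(maximalRealSubfield L)) L (IsCMField.complexConj L) 2 (Matrix.diagonal α)) : GL (Fin 2) (mixedSpace L)) : Matrix (Fin 2) (Fin 2) (mixedSpace L)) = 0 := by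
  haveI : ∀ w : {w : InfinitePlace L // IsComplex w}, SecondCountableTopology (archLocal L 2 (Matrix.diagonal α) w) := fun w => secondCountableTopology_archLocal L 2 (Matrix.diagonal α) w
  -- downward induction: the hypothesis descends from `S₀` to `S₀ ∖ T` for every `T`
  have key : ∀ (T : Finset {w : InfinitePlace L // IsComplex w}) (u : {w : InfinitePlace L // IsComplex w} → Fin 2 → Circle), (∀ w ∈ S₀ \ T, u w 0 ≠ u w 1) →
      ∑ ε : {w : InfinitePlace L // IsComplex w} → Bool,
        ∫ o, Θ (((((archPiEquivCM 2 L (Matrix.diagonal α)).symm o) : arch (↥(maximalRealSubfield L)) L (IsCMField.complexConj L) 2 (Matrix.diagonal α)) : GL (Fin 2) (mixedSpace L)) : Matrix (Fin 2) (Fin 2) (mixedSpace L))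
          ∂(Measure.pi (fun w : {w : InfinitePlace L // IsComplex w} =>
          if w ∈ (S₀ \ T) then (νw w).map (fun g : archLocal L 2 (Matrix.diagonal α) w =>
            g * ⟨circleDiagonal 2 (if ε w then u w ∘ ⇑(Equiv.swap (0 : Fin 2) 1) else u w), circleDiagonal_mem_archLocal_diagonal L 2 α w _⟩ * g⁻¹)
          else Measure.dirac (⟨circleDiagonal 2 ![z w, z w], circleDiagonal_mem_archLocal_diagonal L 2 α w _⟩ : archLocal L 2 (Matrix.diagonal α) w))) = 0 := by
    intro T
    induction T using Finset.induction_on with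
    | empty =>
      intro u hu
      rw [Finset.sdiff_empty] at hu ⊢
      exact hQ u hu
    | insert w₁ T hw₁T ih =>
      intro u hu
      rw [Finset.sdiff_insert] at hu ⊢
      by_cases hmem : w₁ ∈ S₀ \ T
      · refine sum_integral_pi_erase_eq_zero_of_eventuallyEq L α νw z hα Θ hΘ hΘc (S₀ \ T) w₁ hmem (hreal w₁) (hsgn w₁) u
          (fun w hw hne => hu w (Finset.mem_erase.2 ⟨hne, hw⟩)) (fun _ => 0)
          (Filter.Eventually.of_forall fun ψ => differentiableAt_const (0 : E)) ?_ ?_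
        · simp only [deriv_const']
          exact tendsto_const_nhds
        · have hIoo : ∀ᶠ ψ : ℝ in 𝓝[≠] 0, ψ ∈ Ioo (-1 : ℝ) 1 ∧ ψ ≠ 0 :=
            Filter.inter_mem (mem_nhdsWithin_of_mem_nhds (Ioo_mem_nhds (by norm_num) (by norm_num))) self_mem_nhdsWithin
          filter_upwards [hIoo] with ψ hψ
          rw [ih _ ?_, smul_zero]
          intro w hw
          by_cases h : w = w₁
          · subst h
            rw [Function.update_self]
            exact mul_exp_ne_mul_exp_neg (z w) hψ.1 hψ.2
          · rw [Function.update_of_ne h]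
            exact hu w (Finset.mem_erase.2 ⟨h, hw⟩)
      · rw [Finset.erase_eq_of_notMem hmem]
        exact ih u fun w hw => hu w (Finset.mem_erase.2 ⟨ne_of_mem_of_not_mem hw hmem, hw⟩)
  -- `T = S₀`: every place carries the Dirac mass at the centre
  have h0 := key S₀ (fun _ => ![1, 1]) (fun w hw => absurd hw (by rw [Finset.sdiff_self]; exact Finset.notMem_empty w))
  rw [Finset.sdiff_self] at h0
  simp only [Finset.notMem_empty, ↓reduceIte] at h0
  rw [pi_dirac_eq_dirac, integral_dirac, Finset.sum_const, Finset.card_univ, ← Nat.cast_smul_eq_nsmul ℝ] at h0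
  exact (smul_eq_zero.1 h0).resolve_left (Nat.cast_ne_zero.2 Fintype.card_ne_zero)

end Descent

end Literature.NumberTheory.Automorphic.UnitaryGroup

end
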